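import Summits.NavierStokesRegularity.NavierStokesRegularity.Theorems.HardyPointSinkHardyAncientLimitRescaled
import Summits.NavierStokesRegularity.NavierStokesRegularity.Theorems.HardyPointSinkHardyAncientLimitGradient
import Summits.NavierStokesRegularity.NavierStokesRegularity.Theorems.HardyPointSinkHardyAncientLimitHigherReg
import Literature.Analysis.FluidPDE.NSBoundedHigherRegularityQuantProofs
import Literature.Analysis.FluidPDE.SereginSverakBlowupCompactnessProofs
import Literature.Analysis.FluidPDE.CKN1982Setting
import Literature.Analysis.FluidPDE.CKNInterpolationEstimate
import Literature.Analysis.FluidPDE.LocalTypeIScaling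
import Literature.Analysis.FluidPDE.ClassicalNSIRescale
import Literature.Analysis.FluidPDE.SpaceTimeCalculusC1
import Mathlib.Analysis.Calculus.UniformLimitsDeriv
import HarnessLib

/-!
# Route HardyPointSink — `HardyAncientLimit`, step 7d: the scaled quantities `C` and `E` of the
# blow-up limit

Support file for item stmt-NavierStokesRegularity-9138 (`HardyAncientLimit`) of route
`HardyPointSink` (problem `NavierStokesRegularity`).

Along the blow-up `U_k(s, y) = c_k u₁(t_k + c_k² s, x_k + c_k y)` about centres `z_k ∈ Q(1/8)` with
scales `c_k ≤ 1/(20(k+1))`, every fixed parabolic ball `Q(z, r)` with `z.1 ≤ 0` is, for large `k`,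
the image of a ball `Q(Φ_k z, c_k r) ⊆ Q(0, 1/2)`, on which the scale-invariant quantities of
`u₁` are bounded by `𝐈₀`. Fatou's lemma along the pointwise convergence `U_{φ(j)} → W` (and, for
`E`, the convergence of the gradients, `HardyAncientLimit.tendsto_fderiv_of_equicontinuous` fed by
`HardyAncientLimit.eventually_equiHolder_fderiv`) gives (Albritton–Barker 2019, §3: "`u` will
satisfy `𝐈 < ∞`"):

* `HardyAncientLimit.cknC_limit_le` — `C(Q(z, r); W) ≤ 𝐈₀`;
* `HardyAncientLimit.cknE_limit_le` — `E(Q(z, r); ∇W) ≤ 𝐈₀`, with the classical slice gradient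
  `∇W(s, ·)` (which exists at every point of `{s < 0} × ℝ³` as the limit of the `∇U_{φ(j)}(s, ·)`).

## References

* D. Albritton, T. Barker, arXiv:1811.00502, §3.
* L. Caffarelli, R. Kohn, L. Nirenberg, CPAM 35 (1982), §2 (the scaled quantities).
-/

noncomputable section

open Literature.Analysis.FluidPDE Literature.Analysis.FluidPDE.SereginSverak2009
open MeasureTheory Set Function Filter Topology Metric TopologicalSpace
open scoped ENNReal NNReal

namespace Summit.NavierStokesRegularity.NavierStokesRegularity.Theorems

namespace HardyAncientLimit

/-! ### Fatou along an eventually measurable sequence -/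

/-- **Fatou's lemma for an eventually a.e.-measurable sequence**: if `f_j → g` pointwise `μ`-a.e.
and the `f_j` are a.e.-measurable for all large `j`, then `∫⁻ g ≤ liminf ∫⁻ f_j` (shift the
sequence past the bad initial segment; `lintegral_liminf_le'`, `Filter.liminf_nat_add`). [folklore] -/
theorem lintegral_le_liminf_of_tendsto {α : Type*} [MeasurableSpace α] {μ : Measure α}
    {f : ℕ → α → ℝ≥0∞} {g : α → ℝ≥0∞} (hmeas : ∀ᶠ j in atTop, AEMeasurable (f j) μ)
    (hlim : ∀ᵐ x ∂μ, Tendsto (fun j => f j x) atTop (𝓝 (g x))) :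
    ∫⁻ x, g x ∂μ ≤ liminf (fun j => ∫⁻ x, f j x ∂μ) atTop := by
  obtain ⟨j₀, hj₀⟩ := hmeas.exists_forall_of_atTop
  have h1 : ∫⁻ x, g x ∂μ = ∫⁻ x, liminf (fun j => f (j + j₀) x) atTop ∂μ := by
    refine lintegral_congr_ae (hlim.mono fun x hx => ?_)
    exact ((hx.comp (tendsto_add_atTop_nat j₀)).liminf_eq).symm
  rw [h1]
  calc ∫⁻ x, liminf (fun j => f (j + j₀) x) atTop ∂μ
      ≤ liminf (fun j => ∫⁻ x, f (j + j₀) x ∂μ) atTop :=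
        lintegral_liminf_le' fun j => hj₀ (j + j₀) (Nat.le_add_left _ _)
    _ = liminf (fun j => ∫⁻ x, f j x ∂μ) atTop :=
        Filter.liminf_nat_add (fun j => ∫⁻ x, f j x ∂μ) j₀

/-! ### The setting of the blow-up -/

section Blowup

variable {u₁ : ℝ → EuclideanSpace ℝ (Fin 3) → EuclideanSpace ℝ (Fin 3)}
  {U : ℕ → ℝ → EuclideanSpace ℝ (Fin 3) → EuclideanSpace ℝ (Fin 3)}
  {zc : ℕ → ℝ × EuclideanSpace ℝ (Fin 3)} {c : ℕ → ℝ} {I₀ : ℝ≥0∞}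
  {φ : ℕ → ℕ} {W : ℝ × EuclideanSpace ℝ (Fin 3) → EuclideanSpace ℝ (Fin 3)}

/-- **The rescaled balls eventually lie in `Q(0, 1/2)`**: for `z.1 ≤ 0`, `r > 0`, centres
`z_k ∈ Q(1/8)` and scales `0 < c_k ≤ 1/(20(k+1))`, eventually `Q(Φ_k z, c_k r) ⊆ Q(0, 1/2)`.
[folklore] -/
theorem eventually_parabolicCylinder_stAffine_subset_half
    (hzc : ∀ k, zc k ∈ parCyl (0 : ℝ × EuclideanSpace ℝ (Fin 3)) (1 / 8))
    (hc0 : ∀ k, 0 < c k) (hc1 : ∀ k : ℕ, c k ≤ 1 / (20 * ((k : ℝ) + 1)))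
    {z : ℝ × EuclideanSpace ℝ (Fin 3)} (hz : z.1 ≤ 0) {r : ℝ} (hr : 0 < r) :
    ∀ᶠ k in atTop, parabolicCylinder (c k * r) (stAffine (c k ^ 2) (c k) (zc k).1 (zc k).2 z) ⊆
      parabolicCylinder (1 / 2) (0 : ℝ × EuclideanSpace ℝ (Fin 3)) := by
  have hck1 : ∀ k, c k ≤ 1 := fun k => (hc1 k).trans (by
    rw [div_le_one (by positivity)]
    nlinarith [(Nat.cast_nonneg k : (0 : ℝ) ≤ k)])
  filter_upwards [eventually_scale_mul_le hc0 hc1 (|z.1| + r ^ 2 + ‖z.2‖ + r) (by norm_num : (0 : ℝ) < 1 / 8)]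
    with k hk
  exact parabolicCylinder_stAffine_subset_half (hzc k) hz hr (hc0 k) (hck1 k) hk

/-- **The rescaled times eventually stay in `]-1, 0[`**: for centres `z_k ∈ Q(1/8)` and scales
`0 < c_k ≤ 1/(20(k+1))`, for every `L` eventually `t_k + c_k² σ ∈ ]-1, 0[` for all `σ ∈ [-L, 0]`.
[folklore] -/
theorem eventually_time_mem_Ioo
    (hzc : ∀ k, zc k ∈ parCyl (0 : ℝ × EuclideanSpace ℝ (Fin 3)) (1 / 8))
    (hc0 : ∀ k, 0 < c k) (hc1 : ∀ k : ℕ, c k ≤ 1 / (20 * ((k : ℝ) + 1))) (L : ℝ) :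
    ∀ᶠ k in atTop, ∀ σ ∈ Icc (-L) 0, (zc k).1 + c k ^ 2 * σ ∈ Ioo (-1 : ℝ) 0 := by
  have hck1 : ∀ k, c k ≤ 1 := fun k => (hc1 k).trans (by
    rw [div_le_one (by positivity)]
    nlinarith [(Nat.cast_nonneg k : (0 : ℝ) ≤ k)])
  filter_upwards [eventually_scale_mul_le hc0 hc1 |L| (by norm_num : (0 : ℝ) < 1 / 2)] with k hk σ hσ
  have hz := hzc k
  rw [mem_parCyl_zero] at hz
  obtain ⟨⟨ht1, ht2⟩, -, -⟩ := hz
  have hc2 : c k ^ 2 ≤ c k := by nlinarith [hc0 k, hck1 k]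
  have hσ0 : c k ^ 2 * σ ≤ 0 := mul_nonpos_of_nonneg_of_nonpos (sq_nonneg _) hσ.2
  have hσL : -(c k ^ 2 * |L|) ≤ c k ^ 2 * σ := by
    have : -|L| ≤ σ := (neg_le_neg (le_abs_self L)).trans (by linarith [hσ.1])
    nlinarith [sq_nonneg (c k)]
  have h3 : c k ^ 2 * |L| ≤ 1 / 2 := by nlinarith [abs_nonneg L]
  exact ⟨by nlinarith, by linarith⟩

/-- **The slices of the rescaled fields are smooth, eventually**: with `u₁` smooth on
`]-1, 0[ × ℝ³`, for every `s ≤ 0` and all large `k` the slice `U_k(s, ·) = c_k u₁(t_k + c_k² s, x_k + c_k ·)`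
is `C^∞`. [folklore] -/
theorem eventually_contDiff_slice (hsm : IsSmoothSpaceTimeOn (Ioo (-1 : ℝ) 0) u₁)
    (hU : ∀ k, U k = c k • stPull (c k ^ 2) (c k) (zc k).1 (zc k).2 u₁)
    (hzc : ∀ k, zc k ∈ parCyl (0 : ℝ × EuclideanSpace ℝ (Fin 3)) (1 / 8))
    (hc0 : ∀ k, 0 < c k) (hc1 : ∀ k : ℕ, c k ≤ 1 / (20 * ((k : ℝ) + 1))) {s : ℝ} (hs : s ≤ 0) :
    ∀ᶠ k in atTop, ContDiff ℝ ((⊤ : ℕ∞) : WithTop ℕ∞) (U k s) ∧ Differentiable ℝ (u₁ ((zc k).1 + c k ^ 2 * s)) := by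
  filter_upwards [eventually_time_mem_Ioo hzc hc0 hc1 |s|] with k hk
  have ht : (zc k).1 + c k ^ 2 * s ∈ Ioo (-1 : ℝ) 0 := hk s ⟨neg_abs_le s, hs⟩
  have hsl : ContDiff ℝ ((⊤ : ℕ∞) : WithTop ℕ∞) (u₁ ((zc k).1 + c k ^ 2 * s)) := hsm.contDiff_slice ht
  refine ⟨?_, hsl.differentiable (by simp)⟩
  rw [hU k]
  show ContDiff ℝ ((⊤ : ℕ∞) : WithTop ℕ∞) (fun y => c k • stPull (c k ^ 2) (c k) (zc k).1 (zc k).2 u₁ s y)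
  exact (contDiff_stPull_slice hsl).const_smul (c k)

/-- **The rescaled fields are jointly `C¹` (indeed smooth) on a slab containing any fixed ball,
eventually**: for `L ≥ 0`, eventually `U_k` is `C¹` on `]-L - 1, 0[ × ℝ³` hmm — precisely on the
open time set `{σ | t_k + c_k² σ ∈ ]-1, 0[}`, which contains `[-L, 0]`; we record the consequence
used below: the slice-gradient field `(σ, y) ↦ ∇U_k(σ, ·)(y)` is continuous on `]-L, 0[ × ℝ³`.
[folklore] -/
theorem eventually_continuousOn_fderiv_slice (hsm : IsSmoothSpaceTimeOn (Ioo (-1 : ℝ) 0) u₁)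
    (hU : ∀ k, U k = c k • stPull (c k ^ 2) (c k) (zc k).1 (zc k).2 u₁)
    (hzc : ∀ k, zc k ∈ parCyl (0 : ℝ × EuclideanSpace ℝ (Fin 3)) (1 / 8))
    (hc0 : ∀ k, 0 < c k) (hc1 : ∀ k : ℕ, c k ≤ 1 / (20 * ((k : ℝ) + 1))) (L : ℝ) :
    ∀ᶠ k in atTop, ContinuousOn (fun q : ℝ × EuclideanSpace ℝ (Fin 3) => fderiv ℝ (U k q.1) q.2)
        (Ioo (-L) 0 ×ˢ univ) ∧
      ContinuousOn (uncurry (U k)) (Ioo (-L) 0 ×ˢ univ) := by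
  filter_upwards [eventually_time_mem_Ioo hzc hc0 hc1 L] with k hk
  have hsub : Ioo (-L) 0 ⊆ (fun σ => (zc k).1 + c k ^ 2 * σ) ⁻¹' Ioo (-1 : ℝ) 0 :=
    fun σ hσ => hk σ ⟨hσ.1.le, hσ.2.le⟩
  have hsmk : IsSmoothSpaceTimeOn (Ioo (-L) 0) (U k) := by
    rw [hU k]
    exact (hsm.smul_stPull (c k) (c k ^ 2) (c k) (zc k).1 (zc k).2).mono hsub
  refine ⟨?_, hsmk.continuousOn⟩
  exact continuousOn_fderiv_slice_of_contDiffOn (hsmk.of_le (by exact_mod_cast le_top))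
    (uniqueDiffOn_Ioo _ _)

/-- Points of a parabolic ball with vertex in `{s ≤ 0}` have negative times. [folklore] -/
theorem fst_lt_zero_of_mem_parabolicCylinder {r : ℝ} {z q : ℝ × EuclideanSpace ℝ (Fin 3)}
    (hz : z.1 ≤ 0) (hq : q ∈ parabolicCylinder r z) : q.1 < 0 := by
  rw [mem_parabolicCylinder] at hq
  exact hq.1.2.trans_le hz

/-! ### `C` of the limit -/

/-- **The cubic quantity of the blow-up limit is bounded by `𝐈₀`**: `C(Q(z, r); W) ≤ 𝐈₀` for
every parabolic ball with `z.1 ≤ 0` (Fatou along the pointwise convergence `U_{φ(j)} → W`, the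
scale invariance `C(Q(z, r); U_k) = C(Q(Φ_k z, c_k r); u₁)` and the bound on `Q(0, 1/2)`). -/
theorem cknC_limit_le
    (hU : ∀ k, U k = c k • stPull (c k ^ 2) (c k) (zc k).1 (zc k).2 u₁)
    (hzc : ∀ k, zc k ∈ parCyl (0 : ℝ × EuclideanSpace ℝ (Fin 3)) (1 / 8))
    (hc0 : ∀ k, 0 < c k) (hc1 : ∀ k : ℕ, c k ≤ 1 / (20 * ((k : ℝ) + 1)))
    (hIC : ∀ ρ : ℝ, 0 < ρ → ∀ z' : ℝ × EuclideanSpace ℝ (Fin 3),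
      parabolicCylinder ρ z' ⊆ parabolicCylinder (1 / 2) (0 : ℝ × EuclideanSpace ℝ (Fin 3)) →
        cknC ρ z' u₁ ≤ I₀)
    (hcont : ∀ a : ℝ, 0 < a → ∀ᶠ k in atTop, ContinuousOn (uncurry (U k)) (parCylTop a))
    (hφ : StrictMono φ)
    (hpt : ∀ z : ℝ × EuclideanSpace ℝ (Fin 3), z.1 ≤ 0 →
      Tendsto (fun j => uncurry (U (φ j)) z) atTop (𝓝 (W z)))
    {r : ℝ} (hr : 0 < r) {z : ℝ × EuclideanSpace ℝ (Fin 3)} (hz : z.1 ≤ 0) :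
    cknC r z (fun s y => W (s, y)) ≤ I₀ := by
  set Q : Set (ℝ × EuclideanSpace ℝ (Fin 3)) := parabolicCylinder r z with hQ
  have hQm : MeasurableSet Q := (isOpen_parabolicCylinder _ _).measurableSet
  obtain ⟨a, ha1, hQa⟩ := exists_parabolicCylinder_subset_parCylTop hz r
  have ha0 : 0 < a := by linarith
  have hr2 : ENNReal.ofReal r ^ 2 ≠ 0 := pow_ne_zero 2 (by simpa using hr)
  have hr2t : ENNReal.ofReal r ^ 2 ≠ ⊤ := ENNReal.pow_ne_top ENNReal.ofReal_ne_top
  -- Fatou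
  have hmeas : ∀ᶠ j in atTop, AEMeasurable (fun q : ℝ × EuclideanSpace ℝ (Fin 3) =>
      ‖U (φ j) q.1 q.2‖ₑ ^ (3 : ℕ)) (volume.restrict Q) := by
    filter_upwards [hφ.tendsto_atTop.eventually (hcont a ha0)] with j hj
    exact ((hj.mono hQa).aestronglyMeasurable hQm).aemeasurable.enorm.pow_const _
  have hlim : ∀ᵐ q ∂(volume.restrict Q), Tendsto (fun j => ‖U (φ j) q.1 q.2‖ₑ ^ (3 : ℕ)) atTop
      (𝓝 (‖W q‖ₑ ^ (3 : ℕ))) := by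
    refine (ae_restrict_iff' hQm).2 (ae_of_all _ fun q hq => ?_)
    have h1 : Tendsto (fun j => ‖uncurry (U (φ j)) q‖ₑ) atTop (𝓝 ‖W q‖ₑ) :=
      (continuous_enorm.tendsto _).comp (hpt q (fst_lt_zero_of_mem_parabolicCylinder hz hq).le)
    exact ENNReal.Tendsto.pow h1
  have hfatou := lintegral_le_liminf_of_tendsto hmeas hlim
  -- the eventual bound
  have hev : ∀ᶠ j in atTop, ∫⁻ q in Q, ‖U (φ j) q.1 q.2‖ₑ ^ (3 : ℕ) ≤ ENNReal.ofReal r ^ 2 * I₀ := by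
    filter_upwards [hφ.tendsto_atTop.eventually
      (eventually_parabolicCylinder_stAffine_subset_half hzc hc0 hc1 hz hr)] with j hj
    have h1 : cknC r z (U (φ j)) ≤ I₀ := by
      rw [hU (φ j), cknC_nsZoom (hc0 _) hr]
      exact hIC _ (mul_pos (hc0 _) hr) _ hj
    unfold cknC at h1
    calc ∫⁻ q in Q, ‖U (φ j) q.1 q.2‖ₑ ^ (3 : ℕ)
        = ENNReal.ofReal r ^ 2 * ((ENNReal.ofReal r ^ 2)⁻¹ *
            ∫⁻ q in parabolicCylinder r z, ‖U (φ j) q.1 q.2‖ₑ ^ (3 : ℕ)) := by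
          rw [← mul_assoc, ENNReal.mul_inv_cancel hr2 hr2t, one_mul]
      _ ≤ ENNReal.ofReal r ^ 2 * I₀ := mul_le_mul' le_rfl h1
  have hlim' : liminf (fun j => ∫⁻ q in Q, ‖U (φ j) q.1 q.2‖ₑ ^ (3 : ℕ)) atTop ≤
      ENNReal.ofReal r ^ 2 * I₀ := liminf_le_of_frequently_le' hev.frequently
  -- assemble
  unfold cknC
  calc (ENNReal.ofReal r ^ 2)⁻¹ * ∫⁻ q in parabolicCylinder r z, ‖(fun s y => W (s, y)) q.1 q.2‖ₑ ^ (3 : ℕ)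
      = (ENNReal.ofReal r ^ 2)⁻¹ * ∫⁻ q in Q, ‖W q‖ₑ ^ (3 : ℕ) := by rfl
    _ ≤ (ENNReal.ofReal r ^ 2)⁻¹ * (ENNReal.ofReal r ^ 2 * I₀) := mul_le_mul' le_rfl (hfatou.trans hlim')
    _ = I₀ := by rw [← mul_assoc, ENNReal.inv_mul_cancel hr2 hr2t, one_mul]

/-! ### `E` of the limit -/

/-- `E` only sees the gradient on the ball. [folklore] -/
theorem cknE_congr {r : ℝ} {z : ℝ × EuclideanSpace ℝ (Fin 3)}
    {G G' : ℝ → EuclideanSpace ℝ (Fin 3) → EuclideanSpace ℝ (Fin 3) →L[ℝ] EuclideanSpace ℝ (Fin 3)}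
    (h : ∀ q ∈ parabolicCylinder r z, G q.1 q.2 = G' q.1 q.2) : cknE r z G = cknE r z G' := by
  unfold cknE
  congr 1
  exact setLIntegral_congr_fun (isOpen_parabolicCylinder _ _).measurableSet fun q hq => by rw [h q hq]

/-- **The dissipation of the blow-up limit is bounded by `𝐈₀`**: `E(Q(z, r); ∇W) ≤ 𝐈₀` for every
parabolic ball with `z.1 ≤ 0`, where `∇W(s, ·)` is the classical slice gradient (Fatou along the
convergence of the gradients `∇U_{φ(j)}(s, y) → ∇W(s, y)` at every point with `s < 0` —
`tendsto_fderiv_of_equicontinuous` with the uniform Hölder bounds of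
`eventually_equiHolder_fderiv` —, the chain rule `∇U_k(s, y) = c_k² ∇u₁(Φ_k(s, y))`, the scale
invariance of `E` and the bound on `Q(0, 1/2)`). -/
theorem cknE_limit_le (hsm : IsSmoothSpaceTimeOn (Ioo (-1 : ℝ) 0) u₁)
    (hU : ∀ k, U k = c k • stPull (c k ^ 2) (c k) (zc k).1 (zc k).2 u₁)
    (hzc : ∀ k, zc k ∈ parCyl (0 : ℝ × EuclideanSpace ℝ (Fin 3)) (1 / 8))
    (hc0 : ∀ k, 0 < c k) (hc1 : ∀ k : ℕ, c k ≤ 1 / (20 * ((k : ℝ) + 1)))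
    (hIE : ∀ ρ : ℝ, 0 < ρ → ∀ z' : ℝ × EuclideanSpace ℝ (Fin 3),
      parabolicCylinder ρ z' ⊆ parabolicCylinder (1 / 2) (0 : ℝ × EuclideanSpace ℝ (Fin 3)) →
        cknE ρ z' (fun t x => fderiv ℝ (u₁ t) x) ≤ I₀)
    (hcont : ∀ a : ℝ, 0 < a → ∀ᶠ k in atTop, ContinuousOn (uncurry (U k)) (parCylTop a))
    (hb : ∀ a : ℝ, 0 < a → ∀ᶠ k in atTop, ∀ z ∈ parCylTop a, ‖U k z.1 z.2‖ ≤ 1)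
    (hNS : ∀ a : ℝ, 0 < a → ∃ cst : ℝ≥0, ∀ᶠ k in atTop,
      ∃ P : ℝ → EuclideanSpace ℝ (Fin 3) → ℝ,
        IsDistributionalNSSolutionOn (parCylOpens 0 a) 1 0 (U k) P ∧
        ∫⁻ z in parCyl 0 a, ‖P z.1 z.2‖ₑ ^ (3 / 2 : ℝ) ≤ cst)
    (hφ : StrictMono φ)
    (hpt : ∀ z : ℝ × EuclideanSpace ℝ (Fin 3), z.1 ≤ 0 →
      Tendsto (fun j => uncurry (U (φ j)) z) atTop (𝓝 (W z)))
    {r : ℝ} (hr : 0 < r) {z : ℝ × EuclideanSpace ℝ (Fin 3)} (hz : z.1 ≤ 0) :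
    cknE r z (fun s y => fderiv ℝ (fun y => W (s, y)) y) ≤ I₀ := by
  set Q : Set (ℝ × EuclideanSpace ℝ (Fin 3)) := parabolicCylinder r z with hQ
  have hQm : MeasurableSet Q := (isOpen_parabolicCylinder _ _).measurableSet
  have hr1 : ENNReal.ofReal r ≠ 0 := by simpa using hr
  have hr1t : ENNReal.ofReal r ≠ ⊤ := ENNReal.ofReal_ne_top
  -- times of `Q` lie in `]-(|z.1| + r²), 0[`
  set L : ℝ := |z.1| + r ^ 2 with hL
  have hQt : ∀ q ∈ Q, q.1 ∈ Ioo (-L) 0 := by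
    intro q hq
    have hq' := hq
    rw [hQ, mem_parabolicCylinder] at hq'
    refine ⟨?_, fst_lt_zero_of_mem_parabolicCylinder hz hq⟩
    have : -|z.1| ≤ z.1 := neg_abs_le _
    rw [hL]; linarith [hq'.1.1]
  have hφc0 : ∀ j, 0 < c (φ j) := fun j => hc0 _
  -- ## pointwise convergence of the gradients on `Q`
  have hgrad : ∀ q ∈ Q, Tendsto (fun j => fderiv ℝ (U (φ j) q.1) q.2) atTop
      (𝓝 (fderiv ℝ (fun y => W (q.1, y)) q.2)) := by
    intro q hq
    have hs : q.1 < 0 := fst_lt_zero_of_mem_parabolicCylinder hz hq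
    obtain ⟨δ, hδ, B, K, α, hK, hα, hbd, hmod⟩ := eventually_equiHolder_fderiv U hcont hb hNS hs q.2
    have hsl := hφ.tendsto_atTop.eventually (eventually_contDiff_slice hsm hU hzc hc0 hc1 hs.le)
    refine (tendsto_fderiv_of_equicontinuous (f := fun j => U (φ j) q.1) (g := fun y => W (q.1, y))
      hδ ?_ ?_ ?_ hK hα (hφ.tendsto_atTop.eventually hbd) (hφ.tendsto_atTop.eventually hmod)).2
    · exact hsl.mono fun j hj y _ => (hj.1.differentiable (by simp)).differentiableAt
    · exact hsl.mono fun j hj => (hj.1.continuous_fderiv (by simp)).continuousOn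
    · intro y _
      exact hpt (q.1, y) hs.le
  -- ## Fatou
  have hmeas : ∀ᶠ j in atTop, AEMeasurable (fun q : ℝ × EuclideanSpace ℝ (Fin 3) =>
      ENNReal.ofReal (frobeniusNormSq (fderiv ℝ (U (φ j) q.1) q.2))) (volume.restrict Q) := by
    filter_upwards [hφ.tendsto_atTop.eventually (eventually_continuousOn_fderiv_slice hsm hU hzc hc0 hc1 L)]
      with j hj
    have hc : ContinuousOn (fun q : ℝ × EuclideanSpace ℝ (Fin 3) =>
        ENNReal.ofReal (frobeniusNormSq (fderiv ℝ (U (φ j) q.1) q.2))) Q :=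
      (ENNReal.continuous_ofReal.comp continuous_frobeniusNormSq').comp_continuousOn
        (hj.1.mono fun q hq => ⟨hQt q hq, mem_univ _⟩)
    exact (hc.aestronglyMeasurable hQm).aemeasurable
  have hlim : ∀ᵐ q ∂(volume.restrict Q), Tendsto (fun j =>
      ENNReal.ofReal (frobeniusNormSq (fderiv ℝ (U (φ j) q.1) q.2))) atTop
      (𝓝 (ENNReal.ofReal (frobeniusNormSq (fderiv ℝ (fun y => W (q.1, y)) q.2)))) := by
    refine (ae_restrict_iff' hQm).2 (ae_of_all _ fun q hq => ?_)
    exact ((ENNReal.continuous_ofReal.comp continuous_frobeniusNormSq').tendsto _).comp (hgrad q hq)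
  have hfatou := lintegral_le_liminf_of_tendsto hmeas hlim
  -- ## the eventual bound through the chain rule and the scale invariance of `E`
  have hev : ∀ᶠ j in atTop, ∫⁻ q in Q, ENNReal.ofReal (frobeniusNormSq (fderiv ℝ (U (φ j) q.1) q.2)) ≤
      ENNReal.ofReal r * I₀ := by
    filter_upwards [hφ.tendsto_atTop.eventually
      (eventually_parabolicCylinder_stAffine_subset_half hzc hc0 hc1 hz hr),
      hφ.tendsto_atTop.eventually (eventually_time_mem_Ioo hzc hc0 hc1 L)] with j hj hjt
    -- the chain rule on `Q`
    have hchain : ∀ q ∈ Q, fderiv ℝ (U (φ j) q.1) q.2 =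
        ((c (φ j) ^ 2) • stPull (c (φ j) ^ 2) (c (φ j)) (zc (φ j)).1 (zc (φ j)).2
          (fun t x => fderiv ℝ (u₁ t) x)) q.1 q.2 := by
      intro q hq
      have ht : (zc (φ j)).1 + c (φ j) ^ 2 * q.1 ∈ Ioo (-1 : ℝ) 0 :=
        hjt q.1 ⟨(hQt q hq).1.le, (hQt q hq).2.le⟩
      have hd : Differentiable ℝ (u₁ ((zc (φ j)).1 + c (φ j) ^ 2 * q.1)) :=
        (hsm.contDiff_slice ht).differentiable (by simp)
      rw [hU (φ j), fderiv_smul_stPull_slice hd, ← sq]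
      rfl
    have h1 : cknE r z (fun s y => fderiv ℝ (U (φ j) s) y) ≤ I₀ := by
      rw [cknE_congr hchain, cknE_nsZoom (hc0 _) hr]
      exact hIE _ (mul_pos (hc0 _) hr) _ hj
    unfold cknE at h1
    calc ∫⁻ q in Q, ENNReal.ofReal (frobeniusNormSq (fderiv ℝ (U (φ j) q.1) q.2))
        = ENNReal.ofReal r * ((ENNReal.ofReal r)⁻¹ *
            ∫⁻ q in parabolicCylinder r z,
              ENNReal.ofReal (frobeniusNormSq ((fun s y => fderiv ℝ (U (φ j) s) y) q.1 q.2))) := by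
          rw [← mul_assoc, ENNReal.mul_inv_cancel hr1 hr1t, one_mul]
      _ ≤ ENNReal.ofReal r * I₀ := mul_le_mul' le_rfl h1
  have hlim' : liminf (fun j => ∫⁻ q in Q,
      ENNReal.ofReal (frobeniusNormSq (fderiv ℝ (U (φ j) q.1) q.2))) atTop ≤ ENNReal.ofReal r * I₀ :=
    liminf_le_of_frequently_le' hev.frequently
  unfold cknE
  calc (ENNReal.ofReal r)⁻¹ * ∫⁻ q in parabolicCylinder r z,
        ENNReal.ofReal (frobeniusNormSq ((fun s y => fderiv ℝ (fun y => W (s, y)) y) q.1 q.2))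
      ≤ (ENNReal.ofReal r)⁻¹ * (ENNReal.ofReal r * I₀) := mul_le_mul' le_rfl (hfatou.trans hlim')
    _ = I₀ := by rw [← mul_assoc, ENNReal.inv_mul_cancel hr1 hr1t, one_mul]

end Blowup

end HardyAncientLimit

end Summit.NavierStokesRegularity.NavierStokesRegularity.Theorems

end
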